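import Literature.Geometry.Kaehler.ComplexTorusNonSimpleAbelianFourfoldConditionD
import Literature.Geometry.Kaehler.ComplexTorusAnalyticClassesPowersConditionD
import HarnessLib

/-!
# The Hodge conjecture for all powers of the fourfolds `T × E` outside case (a), of `(Y × E') × E` and of `Y₁ × Y₂`
# (Moonen–Zarhin Thm. (0.1) (4): «`ℬ•(Xⁿ) = 𝒟•(Xⁿ)` for all `n`», hence «the Hodge conjecture is “trivially” true for
# all `Xⁿ`»), in the tree's analytic-cycle form `A•(Z) = B•(Z)` for every `Z ∼ Tᵃ × E_τᵇ`

Layer `Literature/Geometry/Kaehler`, namespace `Literature.Geometry.Kaehler.ComplexTorus`; lane `lit-hodgefound`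
(Track 2 foundations library), Layer A4 (known cases of `D = B`), prover seat `lit-hodgefound-p17` (generation 51),
self-proposed row g51-#9 — the cycle-form corollaries of g51-#5 ∕ #6 ∕ #7 (condition (D) for `T × E_τ` outside case (a),
for `(Y × E_{τ'}) × E_τ`, and for `Y₁ × Y₂` not two non-isogenous simple surfaces), in the pattern of g51-#3
(`ComplexTorusAbelianThreefoldPowersHodgeConjecture`: powers of threefolds): condition (D) for `X = X₁ × X₂` passes to
every complex torus isogenous to `X₁ᵃ × X₂ᵇ` (Hazama's remarks, the tree's
`IsIsogenous.forall_powPeriod_divisorClasses_eq_hodgeClasses_of_prod_powPeriod`) and, on an inner-product presentation,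
gives `Aᵖ = Bᵖ` for every `p` (the tree's `IsIsogenous.forall_analyticClasses_eq_hodgeClasses_of_prod_powPeriod_of_forall_powPeriod`:
divisor power products are analytic, analytic classes are Hodge).  THEOREMS ONLY (no definition, no instance, no
notation, no named fact; D-0026, net debt 0).

## Sources, VERBATIM (held `paper:arxiv-math_9901113`)

* B. J. J. Moonen, Yu. G. Zarhin [MoonenZarhin1999LowDim], *Hodge classes on abelian varieties of low dimension*, Math.
  Ann. **315** (1999).  Thm. (0.1) (4) (p0001 L131–L135): «Suppose we are not in one of the cases (a), (b), (c) or (d).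
  Then `Hg(X) = Sp_D(V,φ)` and `ℬ•(Xⁿ) = 𝒟•(Xⁿ)` for all `n`.»; §1 (1.5) (p0004 L61–L66): «(D) … If this condition is
  satisfied then the Hodge conjecture is “trivially” true for all `Xⁿ`.»; §5 (5.4)–(5.5) (p0009 L82–L100): «`X ∼ X₁ ×
  X₂^r` … If `r > 1` then we are reduced to the case `g ≤ 3`».
* H. Lange [Lange2023AbelianVarietiesComplex], *Abelian Varieties over the Complex Numbers* (2023), §7.3.1 (p. 336:
  analytic and Hodge classes, `D•(X) ⊆ A•(X) ⊆ B•(X)`), §7.3.3 Exercise (1)(b) (stably nondegenerate), (2)(c).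
* B. B. Gordon [Gordon1997], *A survey of the Hodge conjecture for abelian varieties*, Thm. 7.5, 7.6.1 (first and third
  remarks: powers and products of stably nondegenerate abelian varieties), 7.6.2.

## Contents (all for complex tori `Z` in any presentation; cycle form on an inner-product presentation `Ψ'`, `e`)

* §1 `Z ∼ Tᵃ × E_τᵇ`, `T` a polarised threefold, outside case (a):
  **`IsIsogenous.forall_powPeriod_divisorClasses_eq_hodgeClasses_of_powPeriod_prod_ellipticPow_of_finrank_eq_three_of_forall_apply_ne`**
  ((D)), **`IsIsogenous.forall_analyticClasses_eq_hodgeClasses_of_powPeriod_prod_ellipticPow_of_finrank_eq_three_of_forall_apply_ne`**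
  (`Aᵖ(Z) = Bᵖ(Z)`); the unconditional variants for `T` NON-simple (`…_of_not_isSimple_of_finrank_eq_three`) and for `E_τ`
  without complex multiplication (`…_of_finrank_eq_three_of_ellipticEnd_eq_bot`).
* §2 `Z ∼ (Y × E_{τ'})ᵃ × E_τᵇ`, `Y` any polarised abelian surface:
  `IsIsogenous.forall_powPeriod_divisorClasses_eq_hodgeClasses_of_powPeriod_prod_ellipticPeriod_prod_ellipticPow_of_finrank_eq_two`,
  **`IsIsogenous.forall_analyticClasses_eq_hodgeClasses_of_powPeriod_prod_ellipticPeriod_prod_ellipticPow_of_finrank_eq_two`**.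
* §3 `Z ∼ Y₁ᵃ × Y₂ᵇ`, `Y₁, Y₂` polarised abelian surfaces, not two non-isogenous simple ones:
  `IsIsogenous.forall_powPeriod_divisorClasses_eq_hodgeClasses_of_powPeriod_prod_powPeriod_of_finrank_eq_two_of_not_isSimple_or_isIsogenous`,
  **`IsIsogenous.forall_analyticClasses_eq_hodgeClasses_of_powPeriod_prod_powPeriod_of_finrank_eq_two_of_not_isSimple_or_isIsogenous`**.
-/

noncomputable section

open Module Matrix NumberField

universe u

namespace Literature.Geometry.Kaehler

namespace ComplexTorus

/-! ## §1 `Z ∼ Tᵃ × E_τᵇ` outside case (a) -/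

section ThreefoldCaseA

variable {κ : Type} [Fintype κ] [DecidableEq κ] [Nonempty κ] {E : Type} [NormedAddCommGroup E] [NormedSpace ℂ E]
  [FiniteDimensional ℂ E] {Ψ : (κ → ℝ) ≃L[ℝ] E} {η : E [⋀^Fin 2]→L[ℝ] ℝ} {τ : ℂ} (hτ : τ.im ≠ 0)
  {κ₀ : Type*} [Fintype κ₀] [DecidableEq κ₀] {F₀ : Type*} [NormedAddCommGroup F₀] [NormedSpace ℂ F₀]
  {Ψ₀ : (κ₀ → ℝ) ≃L[ℝ] F₀}
  {κ' : Type*} [Fintype κ'] [DecidableEq κ'] {E' : Type u} [NormedAddCommGroup E'] [InnerProductSpace ℂ E']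
  [FiniteDimensional ℂ E'] [MeasurableSpace E'] [BorelSpace E'] (Ψ' : (κ' → ℝ) ≃L[ℝ] E') {q : ℕ} (e : Fin q ≃ κ')

/-- **EVERYTHING ISOGENOUS TO `Tᵃ × E_τᵇ` SATISFIES CONDITION (D), `T` a polarised complex abelian threefold, `E_τ` an
elliptic curve, outside case (a)** (when `T` is simple and `E_τ` has complex multiplication by `k = ℚ(τ)`, no ring
embedding of the centre of `End⁰(T)` takes the value `τ`): `𝒟ᵖ(Zᵐ) = ℬᵖ(Zᵐ)` for all `m, p` («`X ∼ X₁ × X₂^r` … `ℬ•(Xⁿ) =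
𝒟•(Xⁿ)` for all `n`»). [cite: MoonenZarhin1999LowDim, Thm. (0.1) (4) (p0001 L131–L135), case (a) (p0001 L77–L80) and §5 (5.4)–(5.5) (p0009 L82–L97)]
[cite: Gordon1997, Thm. 7.5 and 7.6.1] [cite: Lange2023AbelianVarietiesComplex, §7.3.3 Exercise (1)(b), (2)(c)] -/
theorem IsIsogenous.forall_powPeriod_divisorClasses_eq_hodgeClasses_of_powPeriod_prod_ellipticPow_of_finrank_eq_three_of_forall_apply_ne
    {a b : ℕ} (hZ : IsIsogenous Ψ₀ (prodPeriod (powPeriod Ψ a) (powPeriod (ellipticPeriod hτ) b)))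
    (hη : IsRiemannForm Ψ η) (h3 : finrank ℂ E = 3)
    (ha : ∀ hX : IsSimple Ψ, ellipticEnd hτ ≠ ⊥ → ∀ φ : centerField Ψ hX →+* ℂ, ∀ c, φ c ≠ τ) :
    ∀ m p : ℕ, divisorClasses (powPeriod Ψ₀ m) p = hodgeClasses (powPeriod Ψ₀ m) p :=
  hZ.forall_powPeriod_divisorClasses_eq_hodgeClasses_of_prod_powPeriod ⟨η, hη⟩ (isAbelianVariety_ellipticPeriod hτ)
    (hη.forall_divisorClasses_powPeriod_prod_ellipticPeriod_eq_hodgeClasses_of_finrank_eq_three_of_forall_apply_ne hτ h3 ha)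

/-- **THE HODGE `(p,p)`-CONJECTURE IN CYCLE FORM FOR EVERY INNER-PRODUCT TORUS ISOGENOUS TO `Tᵃ × E_τᵇ` OUTSIDE CASE
(a)**: `Aᵖ(Z) = Bᵖ(Z)` for every `p` — every rational `(p,p)`-class is a `ℚ`-combination of fundamental classes of closed
analytic subsets («the Hodge conjecture is “trivially” true for all `Xⁿ`»).
[cite: MoonenZarhin1999LowDim, Thm. (0.1) (4) (p0001 L131–L135) and §1 (1.5) (p0004 L61–L66)] [cite: Lange2023AbelianVarietiesComplex, §7.3.1 (p. 336) and §7.3.3 Exercise (1)(b)] -/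
theorem IsIsogenous.forall_analyticClasses_eq_hodgeClasses_of_powPeriod_prod_ellipticPow_of_finrank_eq_three_of_forall_apply_ne
    {a b : ℕ} (hZ : IsIsogenous Ψ' (prodPeriod (powPeriod Ψ a) (powPeriod (ellipticPeriod hτ) b)))
    (hη : IsRiemannForm Ψ η) (h3 : finrank ℂ E = 3)
    (ha : ∀ hX : IsSimple Ψ, ellipticEnd hτ ≠ ⊥ → ∀ φ : centerField Ψ hX →+* ℂ, ∀ c, φ c ≠ τ) (p : ℕ) :
    analyticClasses Ψ' e p = hodgeClasses Ψ' p :=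
  hZ.forall_analyticClasses_eq_hodgeClasses_of_prod_powPeriod_of_forall_powPeriod Ψ' e ⟨η, hη⟩
    (isAbelianVariety_ellipticPeriod hτ)
    (hη.forall_divisorClasses_powPeriod_prod_ellipticPeriod_eq_hodgeClasses_of_finrank_eq_three_of_forall_apply_ne hτ h3 ha) p

end ThreefoldCaseA

section Threefold

variable {κ : Type} [Fintype κ] [DecidableEq κ] {E : Type} [NormedAddCommGroup E] [NormedSpace ℂ E]
  [FiniteDimensional ℂ E] {Ψ : (κ → ℝ) ≃L[ℝ] E} {η : E [⋀^Fin 2]→L[ℝ] ℝ} {τ : ℂ} (hτ : τ.im ≠ 0)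
  {κ₀ : Type*} [Fintype κ₀] [DecidableEq κ₀] {F₀ : Type*} [NormedAddCommGroup F₀] [NormedSpace ℂ F₀]
  {Ψ₀ : (κ₀ → ℝ) ≃L[ℝ] F₀}
  {κ' : Type*} [Fintype κ'] [DecidableEq κ'] {E' : Type u} [NormedAddCommGroup E'] [InnerProductSpace ℂ E']
  [FiniteDimensional ℂ E'] [MeasurableSpace E'] [BorelSpace E'] (Ψ' : (κ' → ℝ) ≃L[ℝ] E') {q : ℕ} (e : Fin q ≃ κ')

/-- **Everything isogenous to `Tᵃ × E_τᵇ` with `T` a NON-SIMPLE polarised threefold satisfies (D)**, every `E_τ`.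
[cite: MoonenZarhin1999LowDim, Thm. (0.1) (4) and §5 (5.4)–(5.5) (p0009 L82–L97)] [cite: Gordon1997, 7.6.1] -/
theorem IsIsogenous.forall_powPeriod_divisorClasses_eq_hodgeClasses_of_powPeriod_prod_ellipticPow_of_not_isSimple_of_finrank_eq_three
    {a b : ℕ} (hZ : IsIsogenous Ψ₀ (prodPeriod (powPeriod Ψ a) (powPeriod (ellipticPeriod hτ) b)))
    (hη : IsRiemannForm Ψ η) (h3 : finrank ℂ E = 3) (hX : ¬ IsSimple Ψ) :
    ∀ m p : ℕ, divisorClasses (powPeriod Ψ₀ m) p = hodgeClasses (powPeriod Ψ₀ m) p :=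
  hZ.forall_powPeriod_divisorClasses_eq_hodgeClasses_of_prod_powPeriod ⟨η, hη⟩ (isAbelianVariety_ellipticPeriod hτ)
    (hη.forall_divisorClasses_powPeriod_prod_ellipticPeriod_eq_hodgeClasses_of_not_isSimple_of_finrank_eq_three hτ h3 hX)

/-- **`Aᵖ(Z) = Bᵖ(Z)` for every inner-product torus `Z ∼ Tᵃ × E_τᵇ`, `T` a non-simple polarised threefold**, every `E_τ`.
[cite: MoonenZarhin1999LowDim, Thm. (0.1) (4) and §1 (1.5) (p0004 L61–L66)] [cite: Lange2023AbelianVarietiesComplex, §7.3.1 (p. 336)] -/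
theorem IsIsogenous.forall_analyticClasses_eq_hodgeClasses_of_powPeriod_prod_ellipticPow_of_not_isSimple_of_finrank_eq_three
    {a b : ℕ} (hZ : IsIsogenous Ψ' (prodPeriod (powPeriod Ψ a) (powPeriod (ellipticPeriod hτ) b)))
    (hη : IsRiemannForm Ψ η) (h3 : finrank ℂ E = 3) (hX : ¬ IsSimple Ψ) (p : ℕ) :
    analyticClasses Ψ' e p = hodgeClasses Ψ' p :=
  hZ.forall_analyticClasses_eq_hodgeClasses_of_prod_powPeriod_of_forall_powPeriod Ψ' e ⟨η, hη⟩
    (isAbelianVariety_ellipticPeriod hτ)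
    (hη.forall_divisorClasses_powPeriod_prod_ellipticPeriod_eq_hodgeClasses_of_not_isSimple_of_finrank_eq_three hτ h3 hX) p

/-- **Everything isogenous to `Tᵃ × E_τᵇ` with `E_τ` WITHOUT complex multiplication satisfies (D)**, every polarised
threefold `T`. [cite: MoonenZarhin1999LowDim, Thm. (0.1) (4) and §5 (5.4) (p0009 L82–L91)] [cite: Gordon1997, Thm. 7.5 and 7.6.1] -/
theorem IsIsogenous.forall_powPeriod_divisorClasses_eq_hodgeClasses_of_powPeriod_prod_ellipticPow_of_finrank_eq_three_of_ellipticEnd_eq_bot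
    {a b : ℕ} (hZ : IsIsogenous Ψ₀ (prodPeriod (powPeriod Ψ a) (powPeriod (ellipticPeriod hτ) b)))
    (hη : IsRiemannForm Ψ η) (h3 : finrank ℂ E = 3) (hE : ellipticEnd hτ = ⊥) :
    ∀ m p : ℕ, divisorClasses (powPeriod Ψ₀ m) p = hodgeClasses (powPeriod Ψ₀ m) p :=
  hZ.forall_powPeriod_divisorClasses_eq_hodgeClasses_of_prod_powPeriod ⟨η, hη⟩ (isAbelianVariety_ellipticPeriod hτ)
    (hη.forall_divisorClasses_powPeriod_prod_ellipticPeriod_eq_hodgeClasses_of_finrank_eq_three_of_ellipticEnd_eq_bot hτ h3 hE)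

/-- **`Aᵖ(Z) = Bᵖ(Z)` for every inner-product torus `Z ∼ Tᵃ × E_τᵇ` with `E_τ` without complex multiplication**, every
polarised threefold `T`. [cite: MoonenZarhin1999LowDim, Thm. (0.1) (4) and §1 (1.5) (p0004 L61–L66)] [cite: Lange2023AbelianVarietiesComplex, §7.3.1 (p. 336)] -/
theorem IsIsogenous.forall_analyticClasses_eq_hodgeClasses_of_powPeriod_prod_ellipticPow_of_finrank_eq_three_of_ellipticEnd_eq_bot
    {a b : ℕ} (hZ : IsIsogenous Ψ' (prodPeriod (powPeriod Ψ a) (powPeriod (ellipticPeriod hτ) b)))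
    (hη : IsRiemannForm Ψ η) (h3 : finrank ℂ E = 3) (hE : ellipticEnd hτ = ⊥) (p : ℕ) :
    analyticClasses Ψ' e p = hodgeClasses Ψ' p :=
  hZ.forall_analyticClasses_eq_hodgeClasses_of_prod_powPeriod_of_forall_powPeriod Ψ' e ⟨η, hη⟩
    (isAbelianVariety_ellipticPeriod hτ)
    (hη.forall_divisorClasses_powPeriod_prod_ellipticPeriod_eq_hodgeClasses_of_finrank_eq_three_of_ellipticEnd_eq_bot hτ h3 hE) p

end Threefold

/-! ## §2 `Z ∼ (Y × E_{τ'})ᵃ × E_τᵇ` for an abelian surface `Y` -/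

section Surface

variable {κ : Type} [Fintype κ] [DecidableEq κ] {E : Type} [NormedAddCommGroup E] [NormedSpace ℂ E]
  [FiniteDimensional ℂ E] {Ψ : (κ → ℝ) ≃L[ℝ] E} {η : E [⋀^Fin 2]→L[ℝ] ℝ} {τ' τ : ℂ} (hτ' : τ'.im ≠ 0) (hτ : τ.im ≠ 0)
  {κ₀ : Type*} [Fintype κ₀] [DecidableEq κ₀] {F₀ : Type*} [NormedAddCommGroup F₀] [NormedSpace ℂ F₀]
  {Ψ₀ : (κ₀ → ℝ) ≃L[ℝ] F₀}
  {κ' : Type*} [Fintype κ'] [DecidableEq κ'] {E' : Type u} [NormedAddCommGroup E'] [InnerProductSpace ℂ E']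
  [FiniteDimensional ℂ E'] [MeasurableSpace E'] [BorelSpace E'] (Ψ' : (κ' → ℝ) ≃L[ℝ] E') {q : ℕ} (e : Fin q ≃ κ')

/-- **Everything isogenous to `(Y × E_{τ'})ᵃ × E_τᵇ` satisfies (D)** — `Y` ANY polarised complex abelian surface, `E_{τ'}`,
`E_τ` ANY elliptic curves, `a, b ≥ 0` (g51-#6: `(Y × E_{τ'}) × E_τ` satisfies (D); Hazama's remarks).
[cite: MoonenZarhin1999LowDim, Thm. (0.1) (4), §5 (5.4)–(5.5) (p0009 L82–L97) and §3 Cor. (3.9)] [cite: Gordon1997, 7.6.1] -/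
theorem IsIsogenous.forall_powPeriod_divisorClasses_eq_hodgeClasses_of_powPeriod_prod_ellipticPeriod_prod_ellipticPow_of_finrank_eq_two
    {a b : ℕ} (hZ : IsIsogenous Ψ₀ (prodPeriod (powPeriod (prodPeriod Ψ (ellipticPeriod hτ')) a) (powPeriod (ellipticPeriod hτ) b)))
    (hη : IsRiemannForm Ψ η) (h2 : finrank ℂ E = 2) :
    ∀ m p : ℕ, divisorClasses (powPeriod Ψ₀ m) p = hodgeClasses (powPeriod Ψ₀ m) p :=
  hZ.forall_powPeriod_divisorClasses_eq_hodgeClasses_of_prod_powPeriod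
    (IsAbelianVariety.prod ⟨η, hη⟩ (isAbelianVariety_ellipticPeriod hτ')) (isAbelianVariety_ellipticPeriod hτ)
    (hη.forall_divisorClasses_powPeriod_prod_ellipticPeriod_prod_ellipticPeriod_eq_hodgeClasses_of_finrank_eq_two hτ' hτ h2)

/-- **`Aᵖ(Z) = Bᵖ(Z)` for every inner-product torus `Z ∼ (Y × E_{τ'})ᵃ × E_τᵇ`**, `Y` any polarised abelian surface, any
`τ', τ`, `a, b ≥ 0`. [cite: MoonenZarhin1999LowDim, Thm. (0.1) (4) and §1 (1.5) (p0004 L61–L66)] [cite: Lange2023AbelianVarietiesComplex, §7.3.1 (p. 336) and §7.3.3 Exercise (1)(b)] -/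
theorem IsIsogenous.forall_analyticClasses_eq_hodgeClasses_of_powPeriod_prod_ellipticPeriod_prod_ellipticPow_of_finrank_eq_two
    {a b : ℕ} (hZ : IsIsogenous Ψ' (prodPeriod (powPeriod (prodPeriod Ψ (ellipticPeriod hτ')) a) (powPeriod (ellipticPeriod hτ) b)))
    (hη : IsRiemannForm Ψ η) (h2 : finrank ℂ E = 2) (p : ℕ) :
    analyticClasses Ψ' e p = hodgeClasses Ψ' p :=
  hZ.forall_analyticClasses_eq_hodgeClasses_of_prod_powPeriod_of_forall_powPeriod Ψ' e
    (IsAbelianVariety.prod ⟨η, hη⟩ (isAbelianVariety_ellipticPeriod hτ')) (isAbelianVariety_ellipticPeriod hτ)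
    (hη.forall_divisorClasses_powPeriod_prod_ellipticPeriod_prod_ellipticPeriod_eq_hodgeClasses_of_finrank_eq_two hτ' hτ h2) p

end Surface

/-! ## §3 `Z ∼ Y₁ᵃ × Y₂ᵇ` for two abelian surfaces, not two non-isogenous simple ones -/

section TwoSurfaces

variable {κ₁ κ₂ : Type} [Fintype κ₁] [Fintype κ₂] [DecidableEq κ₁] [DecidableEq κ₂] {E₁ E₂ : Type}
  [NormedAddCommGroup E₁] [NormedSpace ℂ E₁] [FiniteDimensional ℂ E₁] [NormedAddCommGroup E₂] [NormedSpace ℂ E₂]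
  [FiniteDimensional ℂ E₂] {Ψ₁ : (κ₁ → ℝ) ≃L[ℝ] E₁} {Ψ₂ : (κ₂ → ℝ) ≃L[ℝ] E₂} {η₁ : E₁ [⋀^Fin 2]→L[ℝ] ℝ}
  {η₂ : E₂ [⋀^Fin 2]→L[ℝ] ℝ}
  {κ₀ : Type*} [Fintype κ₀] [DecidableEq κ₀] {F₀ : Type*} [NormedAddCommGroup F₀] [NormedSpace ℂ F₀]
  {Ψ₀ : (κ₀ → ℝ) ≃L[ℝ] F₀}
  {κ' : Type*} [Fintype κ'] [DecidableEq κ'] {E' : Type u} [NormedAddCommGroup E'] [InnerProductSpace ℂ E']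
  [FiniteDimensional ℂ E'] [MeasurableSpace E'] [BorelSpace E'] (Ψ' : (κ' → ℝ) ≃L[ℝ] E') {q : ℕ} (e : Fin q ≃ κ')

/-- **Everything isogenous to `Y₁ᵃ × Y₂ᵇ` satisfies (D), for polarised abelian surfaces `Y₁, Y₂` with `Y₁` or `Y₂`
not simple or `Y₂ ∼ Y₁`** («If `X₁` and `X₂` are isogenous then we are done»; two non-isogenous simple surfaces —
Prop. (4.2) ∕ Thm. (3.2) — are not treated). [cite: MoonenZarhin1999LowDim, Thm. (0.1) (4) and §5 (5.5) (p0009 L93–L100)] [cite: Gordon1997, 7.6.1] -/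
theorem IsIsogenous.forall_powPeriod_divisorClasses_eq_hodgeClasses_of_powPeriod_prod_powPeriod_of_finrank_eq_two_of_not_isSimple_or_isIsogenous
    {a b : ℕ} (hZ : IsIsogenous Ψ₀ (prodPeriod (powPeriod Ψ₁ a) (powPeriod Ψ₂ b))) (hη₁ : IsRiemannForm Ψ₁ η₁)
    (hη₂ : IsRiemannForm Ψ₂ η₂) (h2₁ : finrank ℂ E₁ = 2) (h2₂ : finrank ℂ E₂ = 2)
    (h : ¬ IsSimple Ψ₁ ∨ ¬ IsSimple Ψ₂ ∨ IsIsogenous Ψ₂ Ψ₁) :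
    ∀ m p : ℕ, divisorClasses (powPeriod Ψ₀ m) p = hodgeClasses (powPeriod Ψ₀ m) p :=
  hZ.forall_powPeriod_divisorClasses_eq_hodgeClasses_of_prod_powPeriod ⟨η₁, hη₁⟩ ⟨η₂, hη₂⟩
    (hη₁.forall_divisorClasses_powPeriod_prod_eq_hodgeClasses_of_finrank_eq_two_of_not_isSimple_or_isIsogenous hη₂ h2₁
      h2₂ h)

/-- **`Aᵖ(Z) = Bᵖ(Z)` for every inner-product torus `Z ∼ Y₁ᵃ × Y₂ᵇ`**, `Y₁, Y₂` polarised abelian surfaces with `Y₁` or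
`Y₂` not simple or `Y₂ ∼ Y₁`. [cite: MoonenZarhin1999LowDim, Thm. (0.1) (4), §1 (1.5) (p0004 L61–L66) and §5 (5.5)]
[cite: Lange2023AbelianVarietiesComplex, §7.3.1 (p. 336) and §7.3.3 Exercise (1)(b)] -/
theorem IsIsogenous.forall_analyticClasses_eq_hodgeClasses_of_powPeriod_prod_powPeriod_of_finrank_eq_two_of_not_isSimple_or_isIsogenous
    {a b : ℕ} (hZ : IsIsogenous Ψ' (prodPeriod (powPeriod Ψ₁ a) (powPeriod Ψ₂ b))) (hη₁ : IsRiemannForm Ψ₁ η₁)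
    (hη₂ : IsRiemannForm Ψ₂ η₂) (h2₁ : finrank ℂ E₁ = 2) (h2₂ : finrank ℂ E₂ = 2)
    (h : ¬ IsSimple Ψ₁ ∨ ¬ IsSimple Ψ₂ ∨ IsIsogenous Ψ₂ Ψ₁) (p : ℕ) :
    analyticClasses Ψ' e p = hodgeClasses Ψ' p :=
  hZ.forall_analyticClasses_eq_hodgeClasses_of_prod_powPeriod_of_forall_powPeriod Ψ' e ⟨η₁, hη₁⟩ ⟨η₂, hη₂⟩
    (hη₁.forall_divisorClasses_powPeriod_prod_eq_hodgeClasses_of_finrank_eq_two_of_not_isSimple_or_isIsogenous hη₂ h2₁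
      h2₂ h) p

end TwoSurfaces

end ComplexTorus

end Literature.Geometry.Kaehler
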